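import Summits.NavierStokesRegularity.NavierStokesRegularity.Theorems.ScaledTopAlignmentAprioriMostTimesBulkAlignmentStubCoherenceToMostTimes
import HarnessLib

/-!
# Route `ScaledTopAlignment`, crux `AprioriMostTimesBulkAlignment` (stmt-NavierStokesRegularity-19551), line `birth`,
# stub `stub_regularNearMaxCoherence`: the REGULAR CASE of the class-#2 hypothesis H₂ (relative-level window coherence)

The lead's birth cut of the crux (ns-sta-19551-p1 g2, 2026-08-26: kit stub `stub_coherence_to_mostTimes` — closed by
`Theorems.stub_coherence_to_mostTimes`, p449019 —, regular case `stub_regularNearMaxCoherence`, singular case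
`stub_singularNearMaxCoherence` = the open content) asks in its regular-case stub: a classical solution of the unforced
Navier–Stokes system on `ℝ³ × [0, T)` (`ν, T > 0`), Leray–Hopf from its rapidly decaying datum, that EXTENDS classically
past `T`, has relative-level window coherence of the vorticity direction at `u` — `∃ λ₀ < 1, R₀ > 0, η → 0` at `0⁺`,
`∀ κ > 0 ∃ M > 0`: for `t ∈ [0,T)`, rate-near-max `x` and `y ≠ x` in the window at relative level, the signed chord of
the directions is `≤ η(‖x − y‖)`.

`stub_regularNearMaxCoherence` (registered name and signature) is `Theorems.relLevelWindowCoherenceAt_of_hasSmoothExtensionPast`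
(file `ScaledTopAlignmentAprioriMostTimesBulkAlignmentStubCoherenceToMostTimes.lean`): `λ₀ = ½`, `R₀ = 1`, `η = id` and
`M = 2L`, `L` the uniform spatial Lipschitz constant of the vorticity on the slab `[0, T) × ℝ³` of a solution that extends
past `T` (`exists_lipschitz_curl_of_hasSmoothExtensionPast`: Tao 2013 Sobolev bounds on the closed slab); chord
`≤ 2‖ω(x) − ω(y)‖/|ω(x)| ≤ 2L‖x − y‖/(2L)`. The classical-solution hypothesis is carried by the signature and not used.
So all open content of the class-#2 line sits in `stub_singularNearMaxCoherence` (first blow-up times), whose Type-I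
case is `ThreadingFlux.Target` (stmt-1217) by `Theorems.relLevelWindowCoherence_doorCalculus`.
WHAT THIS IS NOT: not NS regularity; the provable half of H₂ only. hard core evaded: NO.
-/

noncomputable section

-- the summit and its single sub-problem share the name (CONVENTIONS §1), as in every Theorems file
set_option linter.dupNamespace false

open MeasureTheory Set Filter Topology

namespace Summit.NavierStokesRegularity.NavierStokesRegularity.Theorems

open Literature.Analysis Literature.Analysis.FluidPDE

/-- **Stub `stub_regularNearMaxCoherence` of the birth line of crux `AprioriMostTimesBulkAlignment`
(stmt-NavierStokesRegularity-19551), registered signature: the regular case of relative-level window coherence.**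
A classical Leray–Hopf solution from a rapidly decaying datum on `[0, T)` that extends classically past `T` satisfies H₂
at `u` (`λ₀ = ½`, `R₀ = 1`, `η = id`, `M = 2L`; `relLevelWindowCoherenceAt_of_hasSmoothExtensionPast`). [folklore] -/
theorem stub_regularNearMaxCoherence :
    ∀ (ν T : ℝ), 0 < ν → 0 < T → ∀ (u : ℝ → EuclideanSpace ℝ (Fin 3) → EuclideanSpace ℝ (Fin 3)) (p : ℝ → EuclideanSpace ℝ (Fin 3) → ℝ), IsClassicalNSSolutionOn (Set.Ico 0 T) ν 0 u p → IsLerayHopfOn T ν 0 (u 0) u → HasRapidSpatialDecay (u 0) → HasSmoothExtensionPast ν 0 u T → ∃ lam0 : ℝ, lam0 < 1 ∧ ∃ R0 : ℝ, 0 < R0 ∧ ∃ η : ℝ → ℝ, Tendsto η (𝓝[>] 0) (𝓝 0) ∧ ∀ κ : ℝ, 0 < κ → ∃ M : ℝ, 0 < M ∧ ∀ t ∈ Set.Ico 0 T, ∀ x y : EuclideanSpace ℝ (Fin 3), M ≤ ‖curl (u t) x‖ → κ / (T - t) ≤ ‖curl (u t) x‖ → lam0 * ‖curl (u t) x‖ ≤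 ‖curl (u t) y‖ → ‖x - y‖ ≤ R0 * Real.sqrt (ν / ‖curl (u t) x‖) → x ≠ y → ‖(‖curl (u t) x‖⁻¹ • curl (u t) x) - (‖curl (u t) y‖⁻¹ • curl (u t) y)‖ ≤ η ‖x - y‖ := by
  intro ν T hν hT u _p _hcl hLH hdec hext
  exact relLevelWindowCoherenceAt_of_hasSmoothExtensionPast hν hT hLH hdec hext

/-- **Where the open content of H₂ sits: compact sub-intervals are free.** For a classical solution on `ℝ³ × [0, T)`,
Leray–Hopf from its rapidly decaying datum, and `0 < T'' < T`, relative-level window coherence holds for the restricted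
clock `T''` (rate floor `κ/(T'' − t)`, times `t ∈ [0, T'')`) — unconditionally: the solution is its own classical
extension past `T''` (witness `(T, u, p)`), the restriction is classical on `[0, T'')` and Leray–Hopf on `[0, T'')`
(`IsLerayHopfOn.of_le`). Hence ALL content of the physics stub is the behaviour as `T'' ↑ T` at a first blow-up time
(`stub_singularNearMaxCoherence`). [folklore] -/
theorem relLevelWindowCoherenceAt_of_lt {ν T : ℝ} (hν : 0 < ν)
    {u : ℝ → EuclideanSpace ℝ (Fin 3) → EuclideanSpace ℝ (Fin 3)} {p : ℝ → EuclideanSpace ℝ (Fin 3) → ℝ}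
    (hcl : IsClassicalNSSolutionOn (Ico 0 T) ν 0 u p) (hLH : IsLerayHopfOn T ν 0 (u 0) u)
    (hdec : HasRapidSpatialDecay (u 0)) {T'' : ℝ} (hT''0 : 0 < T'') (hT''T : T'' < T) :
    ∃ lam0 : ℝ, lam0 < 1 ∧ ∃ R0 : ℝ, 0 < R0 ∧ ∃ η : ℝ → ℝ, Tendsto η (𝓝[>] 0) (𝓝 0) ∧
      ∀ κ : ℝ, 0 < κ → ∃ M : ℝ, 0 < M ∧ ∀ t ∈ Set.Ico 0 T'', ∀ x y : EuclideanSpace ℝ (Fin 3),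
        M ≤ ‖curl (u t) x‖ → κ / (T'' - t) ≤ ‖curl (u t) x‖ → lam0 * ‖curl (u t) x‖ ≤ ‖curl (u t) y‖ →
        ‖x - y‖ ≤ R0 * Real.sqrt (ν / ‖curl (u t) x‖) → x ≠ y →
        ‖(‖curl (u t) x‖⁻¹ • curl (u t) x) - (‖curl (u t) y‖⁻¹ • curl (u t) y)‖ ≤ η ‖x - y‖ := by
  have hext : HasSmoothExtensionPast ν 0 u T'' := ⟨T, hT''T, u, p, hcl, fun _ _ => rfl⟩
  exact relLevelWindowCoherenceAt_of_hasSmoothExtensionPast hν hT''0 (hLH.of_le hT''T.le) hdec hext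


/-! ### Appendix (ns-sta-19551-p3, after p449837): where the one OPEN stub `stub_singularNearMaxCoherence` sits -/

/-- **The singular stub carries the whole a-priori class-#2 hypothesis.** The statement of the lead's open stub
`stub_singularNearMaxCoherence` (H₂ at every classical Leray–Hopf solution from a rapidly decaying datum that does NOT
extend classically past `T`) implies H₂ at EVERY such solution — the physics stub `stub_aprioriNearMaxCoherence` of the
two-stub cut —, by excluded middle on continuation past `T` and the landed regular case `stub_regularNearMaxCoherence`.
(The converse is specialisation.) [folklore] -/
theorem aprioriRelLevelWindowCoherence_of_singularNearMaxCoherence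
    (hS : ∀ (ν T : ℝ), 0 < ν → 0 < T → ∀ (u : ℝ → EuclideanSpace ℝ (Fin 3) → EuclideanSpace ℝ (Fin 3)) (p : ℝ → EuclideanSpace ℝ (Fin 3) → ℝ), IsClassicalNSSolutionOn (Set.Ico 0 T) ν 0 u p → IsLerayHopfOn T ν 0 (u 0) u → HasRapidSpatialDecay (u 0) → ¬ HasSmoothExtensionPast ν 0 u T → ∃ lam0 : ℝ, lam0 < 1 ∧ ∃ R0 : ℝ, 0 < R0 ∧ ∃ η : ℝ → ℝ, Tendsto η (𝓝[>] 0) (𝓝 0) ∧ ∀ κ : ℝ, 0 < κ → ∃ M : ℝ, 0 < M ∧ ∀ t ∈ Set.Ico 0 T, ∀ x y : EuclideanSpace ℝ (Fin 3), M ≤ ‖curl (u t) x‖ → κ / (T - t) ≤ ‖curl (u t) x‖ → lam0 * ‖curl (u t) x‖ ≤ ‖curl (u t) y‖ → ‖x - y‖ ≤ R0 * Real.sqrt (ν / ‖curl (u t) x‖) → x ≠ y → ‖(‖curl (u t) x‖⁻¹ • curl (u t) x) - (‖curl (u t) y‖⁻¹ • curl (u t) y)‖ ≤ η ‖x - y‖)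 :
    ∀ (ν T : ℝ), 0 < ν → 0 < T → ∀ (u : ℝ → EuclideanSpace ℝ (Fin 3) → EuclideanSpace ℝ (Fin 3))
      (p : ℝ → EuclideanSpace ℝ (Fin 3) → ℝ), IsClassicalNSSolutionOn (Set.Ico 0 T) ν 0 u p →
      IsLerayHopfOn T ν 0 (u 0) u → HasRapidSpatialDecay (u 0) →
      ∃ lam0 : ℝ, lam0 < 1 ∧ ∃ R0 : ℝ, 0 < R0 ∧ ∃ η : ℝ → ℝ, Tendsto η (𝓝[>] 0) (𝓝 0) ∧
        ∀ κ : ℝ, 0 < κ → ∃ M : ℝ, 0 < M ∧ ∀ t ∈ Set.Ico 0 T, ∀ x y : EuclideanSpace ℝ (Fin 3),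
          M ≤ ‖curl (u t) x‖ → κ / (T - t) ≤ ‖curl (u t) x‖ → lam0 * ‖curl (u t) x‖ ≤ ‖curl (u t) y‖ →
          ‖x - y‖ ≤ R0 * Real.sqrt (ν / ‖curl (u t) x‖) → x ≠ y →
          ‖(‖curl (u t) x‖⁻¹ • curl (u t) x) - (‖curl (u t) y‖⁻¹ • curl (u t) y)‖ ≤ η ‖x - y‖ := by
  intro ν T hν hT u p hcl hLH hdec
  by_cases hext : HasSmoothExtensionPast ν 0 u T
  · exact stub_regularNearMaxCoherence ν T hν hT u p hcl hLH hdec hext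
  · exact hS ν T hν hT u p hcl hLH hdec hext

/-- **Hard-core location of the one OPEN stub.** (i) A proof of `stub_singularNearMaxCoherence` proves the hard core
«no Type-I blow-up» = `ThreadingFlux.Target` (stmt-NavierStokesRegularity-1217): H₂ at a Type-I first blow-up would force
extension past `T` (`hasSmoothExtensionPast_of_relLevelWindowCoherenceAt_of_typeI`, p5's zoom kit), so under the stub no
solution of the class has a Type-I first blow-up (door calculus `relLevelWindowCoherence_doorCalculus`, first conjunct,
with `aprioriRelLevelWindowCoherence_of_singularNearMaxCoherence`). (ii) Given the route's residual `NoTypeII` the open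
stub IS the hard core — `stub_singularNearMaxCoherence ↔ Target`: under `NoTypeII` a non-extendable solution is maximal,
hence Type I, and under Target a Type-I solution extends, so the singular case is VACUOUS. Hence the stub's honest verdict
is `blocked-on: stmt-NavierStokesRegularity-1217`, exactly as for the parent crux (census CENSUS-19551.md
699b0fb814a51823): class #2 changes the door's language (print separation), not its distance from the hard core.
[folklore] -/
theorem singularNearMaxCoherence_hardCore :
    ((∀ (ν T : ℝ), 0 < ν → 0 < T → ∀ (u : ℝ → EuclideanSpace ℝ (Fin 3) → EuclideanSpace ℝ (Fin 3)) (p : ℝ → EuclideanSpace ℝ (Fin 3) → ℝ), IsClassicalNSSolutionOn (Set.Ico 0 T) ν 0 u p → IsLerayHopfOn T ν 0 (u 0) u → HasRapidSpatialDecay (u 0) → ¬ HasSmoothExtensionPast ν 0 u T → ∃ lam0 : ℝ, lam0 < 1 ∧ ∃ R0 : ℝ, 0 < R0 ∧ ∃ η : ℝ → ℝ, Tendsto η (𝓝[>] 0) (𝓝 0) ∧ ∀ κ : ℝ, 0 < κ → ∃ M : ℝ, 0 < M ∧ ∀ t ∈ Set.Ico 0 T, ∀ x y : EuclideanSpace ℝ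 (Fin 3), M ≤ ‖curl (u t) x‖ → κ / (T - t) ≤ ‖curl (u t) x‖ → lam0 * ‖curl (u t) x‖ ≤ ‖curl (u t) y‖ → ‖x - y‖ ≤ R0 * Real.sqrt (ν / ‖curl (u t) x‖) → x ≠ y → ‖(‖curl (u t) x‖⁻¹ • curl (u t) x) - (‖curl (u t) y‖⁻¹ • curl (u t) y)‖ ≤ η ‖x - y‖) →
      Summit.NavierStokesRegularity.NavierStokesRegularity.Theses.ThreadingFlux.Target) ∧
    (Summit.NavierStokesRegularity.NavierStokesRegularity.Theses.ScaledTopAlignment.NoTypeII →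
      ((∀ (ν T : ℝ), 0 < ν → 0 < T → ∀ (u : ℝ → EuclideanSpace ℝ (Fin 3) → EuclideanSpace ℝ (Fin 3)) (p : ℝ → EuclideanSpace ℝ (Fin 3) → ℝ), IsClassicalNSSolutionOn (Set.Ico 0 T) ν 0 u p → IsLerayHopfOn T ν 0 (u 0) u → HasRapidSpatialDecay (u 0) → ¬ HasSmoothExtensionPast ν 0 u T → ∃ lam0 : ℝ, lam0 < 1 ∧ ∃ R0 : ℝ, 0 < R0 ∧ ∃ η : ℝ → ℝ, Tendsto η (𝓝[>] 0) (𝓝 0) ∧ ∀ κ : ℝ, 0 < κ → ∃ M : ℝ, 0 < M ∧ ∀ t ∈ Set.Ico 0 T, ∀ x y : EuclideanSpace ℝ (Fin 3), M ≤ ‖curl (u t) x‖ → κ / (T - t) ≤ ‖curl (u t) x‖ → lam0 * ‖curl (u t) x‖ ≤ ‖curl (u t) y‖ → ‖x - y‖ ≤ R0 * Real.sqrt (ν / ‖curl (u t) x‖) → x ≠ y → ‖(‖curl (u t) x‖⁻¹ • curl (u t) x) - (‖curl (u t) y‖⁻¹ • curl (u t) y)‖ ≤ η ‖x - y‖) 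↔
        Summit.NavierStokesRegularity.NavierStokesRegularity.Theses.ThreadingFlux.Target)) := by
  have hfwd : (∀ (ν T : ℝ), 0 < ν → 0 < T → ∀ (u : ℝ → EuclideanSpace ℝ (Fin 3) → EuclideanSpace ℝ (Fin 3)) (p : ℝ → EuclideanSpace ℝ (Fin 3) → ℝ), IsClassicalNSSolutionOn (Set.Ico 0 T) ν 0 u p → IsLerayHopfOn T ν 0 (u 0) u → HasRapidSpatialDecay (u 0) → ¬ HasSmoothExtensionPast ν 0 u T → ∃ lam0 : ℝ, lam0 < 1 ∧ ∃ R0 : ℝ, 0 < R0 ∧ ∃ η : ℝ → ℝ, Tendsto η (𝓝[>] 0) (𝓝 0) ∧ ∀ κ : ℝ, 0 < κ → ∃ M : ℝ, 0 < M ∧ ∀ t ∈ Set.Ico 0 T, ∀ x y : EuclideanSpace ℝ (Fin 3), M ≤ ‖curl (u t) x‖ → κ / (T - t) ≤ ‖curl (u t) x‖ → lam0 * ‖curl (u t) x‖ ≤ ‖curl (u t) y‖ → ‖x - y‖ ≤ R0 * Real.sqrt (ν / ‖curl (u t) x‖) → x ≠ y → ‖(‖curl (u t) x‖⁻¹ •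 curl (u t) x) - (‖curl (u t) y‖⁻¹ • curl (u t) y)‖ ≤ η ‖x - y‖) →
      Summit.NavierStokesRegularity.NavierStokesRegularity.Theses.ThreadingFlux.Target := fun hS =>
    relLevelWindowCoherence_doorCalculus.1.1 fun ν T hν hT u p hcl hLH hdec _hI =>
      aprioriRelLevelWindowCoherence_of_singularNearMaxCoherence hS ν T hν hT u p hcl hLH hdec
  refine ⟨hfwd, fun hII => ⟨hfwd, fun hT ν T hν hT0 u p hcl hLH hdec hne => ?_⟩⟩
  exact absurd (hT ν T hν hT0 u p hcl hLH hdec (hII ν T hν hT0 u p ⟨hcl, hne⟩ hLH hdec)) hne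

end Summit.NavierStokesRegularity.NavierStokesRegularity.Theorems

end
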